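import Mathlib.LinearAlgebra.Complex.Module
import Mathlib.MeasureTheory.Measure.Lebesgue.EqHaar
import Literature.IUT.LogVolume.ArchimedeanTensorCopiesDecomposition
import Literature.IUT.LogVolume.ArchimedeanPacketLogVolume
import HarnessLib

/-!
# Archimedean tensor packets: scaling of the normalised log-volume under multiplication by an ELEMENT of the
# packet (coordinatewise complex scaling) — the archimedean analogue of `μ^log(ι_i(g)·A) = μ^log(A) + log‖g‖`

S. Mochizuki, *Topics in absolute anabelian geometry III*, Prop. 5.7 (ii)(b), p. 138: at an archimedean `k`,
"`μ^log_k(x·A) = μ^log_k(A) + μ̇^log_k(x)`" (radial log-volumes move by `log|x|`); *Inter-universal Teichmüller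
theory IV*, kurims Apr-2020 ms, Prop. 1.5 (iii) p. 15 (the direct sum decomposition `M_I ≅ ⊕_{j∈J} ℂ` of the
archimedean tensor packet and its direct-sum metric / integral structure `B_I`) and Thm. 1.10 Step (vii) p. 30
(log-volumes on `M_I`); *IUT III* Prop. 3.9 (i) p. 116 ("the sum of the radial log-volumes on each of the
direct summand complex archimedean fields … packet-normalization").
[cite: MochizukiAbsTopIII2015, Prop. 5.7 (ii)(b) p. 138] [cite: Mochizuki2012, IUTchIV Prop. 1.5 (iii) p. 15]

Campaign S (`ArchimedeanPacketLogVolume.lean`, abc-iut-L5-t7 / S-crew) has the normalised log-volume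
`nlogVol J S = (dim_ℝ)⁻¹·(log vol S − log vol B)` on `⊕_{j∈J} ℂ` and `packetLogVol Φ S` on `M_I` through a
decomposition `Φ`, with the scaling law for REAL scalars only (`nlogVol_smul`, `packetLogVol_smul`). THIS
proof-only file (seat abc-iut-w5-d178; the one analysis lemma named as missing for the capsule (|A| ≥ 2)
extension of the genuine Haar model of [IUTchIII] Prop. 3.9 (iii), plan/L6/SUBDAG-IUTchIII-Prop-39.md residual
R-iii, abc-iut-L6-d3 g3 p415871 HONEST SCOPE (2)) supplies the law for multiplication by an ELEMENT:

* `Complex.det_mulLeft_real` — the `ℝ`-determinant of `z ↦ c·z` on `ℂ` is `|c|²` (matrix `[[a,−b],[b,a]]`);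
* `det_coordMul` — on `⊕_{j∈J} ℂ` the `ℝ`-determinant of `y ↦ (c_j·y_j)_j` is `∏_j |c_j|²` (Mathlib
  `LinearMap.det_pi`);
* **`volume_image_coordMul`** — `vol((c_j·y_j)_j-image of S) = (∏_j |c_j|²)·vol(S)` (Lebesgue = Haar measure
  scales by `|det|`);
* **`nlogVol_image_coordMul`** — for `c_j ≠ 0` and `S` of positive finite volume,
  `nlogVol((c·y) '' S) = (1/|J|)·Σ_j log|c_j| + nlogVol S` (the `dim_ℝ = 2|J|` normalisation turns
  `Σ_j 2 log|c_j|` into the AVERAGE of the `log|c_j|`: "packet-normalization" at `∞`);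
* **`packetLogVol_image_mul`** — on `M_I` with a decomposition `Φ` (an `ℝ`-ALGEBRA isomorphism, so
  `Φ(t·x) = Φ(t)·Φ(x)` coordinatewise): `packetLogVol Φ ((t·) '' S) = (1/|J|)·Σ_j log|Φ(t)_j| + packetLogVol Φ S`
  whenever all coordinates `Φ(t)_j ≠ 0`; for a pure tensor `t = ⊗_i m_i` and the canonical decomposition the
  coordinates are the characters `∏_i cj(ε_i)(m_i(w_i))` (`canonicalDecomposition_tprod`), of absolute value
  `∏_i |m_i(w_i)|` (`norm_canonicalDecomposition_tprod`).

Classical Lebesgue-measure bookkeeping; no new definitions; nothing here bears on the disputed [IUTchIII]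
Cor. 3.12 or takes a side.
-/

noncomputable section

namespace Literature.IUT.LogVolume

open MeasureTheory MeasureTheory.Measure Set Complex
open scoped ENNReal Pointwise ComplexConjugate

/-! ## The `ℝ`-determinant of complex multiplication -/

/-- The `ℝ`-linear map `z ↦ c·z` on `ℂ` has determinant `|c|² = c.re² + c.im²` (its matrix in the basis
`{1, i}` is `[[re c, −im c], [im c, re c]]`). [cite: MochizukiAbsTopIII2015, Prop. 5.7 (ii)(b) p. 138] -/
theorem Complex.det_mulLeft_real (c : ℂ) : LinearMap.det (LinearMap.mulLeft ℝ c) = Complex.normSq c := by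
  rw [← LinearMap.det_toMatrix Complex.basisOneI]
  have hM : LinearMap.toMatrix Complex.basisOneI Complex.basisOneI (LinearMap.mulLeft ℝ c) =
      !![c.re, -c.im; c.im, c.re] := by
    ext i j
    rw [LinearMap.toMatrix_apply, Complex.coe_basisOneI_repr, Complex.coe_basisOneI]
    fin_cases i <;> fin_cases j <;> simp
  rw [hM, Matrix.det_fin_two_of, Complex.normSq_apply]
  ring

/-! ## Coordinatewise complex scaling on `⊕_{j∈J} ℂ` -/

section Coord

variable {J : Type} [Fintype J]

/-- The `ℝ`-linear map `y ↦ (c_j·y_j)_j` on `⊕_{j∈J} ℂ` (private plumbing through `LinearMap.pi`; no new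
public decl). [folklore] -/
private def coordMul (c : J → ℂ) : (J → ℂ) →ₗ[ℝ] (J → ℂ) :=
  LinearMap.pi fun j => (LinearMap.mulLeft ℝ (c j)).comp (LinearMap.proj j)

omit [Fintype J] in
/-- Unfolding `coordMul` (private plumbing). [folklore] -/
private theorem coordMul_apply (c : J → ℂ) (y : J → ℂ) : coordMul c y = fun j => c j * y j := rfl

/-- `det_ℝ (y ↦ (c_j·y_j)_j) = ∏_j |c_j|²`. [cite: Mochizuki2012, IUTchIV Prop. 1.5 (iii) p. 15] -/
theorem det_coordMul (c : J → ℂ) :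
    LinearMap.det (LinearMap.pi fun j => (LinearMap.mulLeft ℝ (c j)).comp (LinearMap.proj j) :
      (J → ℂ) →ₗ[ℝ] (J → ℂ)) = ∏ j, Complex.normSq (c j) := by
  classical
  rw [LinearMap.det_pi]
  exact Finset.prod_congr rfl fun j _ => Complex.det_mulLeft_real (c j)

/-- **Lebesgue measure under coordinatewise complex scaling**: `vol({(c_j·y_j)_j | y ∈ S}) = (∏_j |c_j|²)·vol(S)`.
[cite: MochizukiAbsTopIII2015, Prop. 5.7 (ii)(b) p. 138] -/
theorem volume_image_coordMul (c : J → ℂ) (S : Set (J → ℂ)) :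
    volume ((fun y : J → ℂ => fun j => c j * y j) '' S) = ENNReal.ofReal (∏ j, ‖c j‖ ^ 2) * volume S := by
  classical
  have h := addHaar_image_linearMap (μ := (volume : Measure (J → ℂ))) (coordMul c) S
  have hf : ((coordMul c : (J → ℂ) →ₗ[ℝ] (J → ℂ)) : (J → ℂ) → (J → ℂ)) = fun y j => c j * y j := by
    funext y; exact coordMul_apply c y
  rw [hf] at h
  rw [h, coordMul, det_coordMul]
  congr 2
  rw [Finset.abs_prod]
  exact Finset.prod_congr rfl fun j _ => by
    rw [abs_of_nonneg (Complex.normSq_nonneg _), Complex.normSq_eq_norm_sq]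

/-- **The normalised log-volume under coordinatewise complex scaling** (all `c_j ≠ 0`, `S` of positive finite
volume): `nlogVol((c·y) '' S) = (1/|J|)·Σ_j log|c_j| + nlogVol(S)` — each summand's radial log-volume moves by
`log|c_j|` ([AbsTopIII] Prop. 5.7 (ii)(b)) and the packet-normalisation averages over the `|J|` summands.
[cite: MochizukiAbsTopIII2015, Prop. 5.7 (ii)(b) p. 138] -/
theorem nlogVol_image_coordMul [Nonempty J] (c : J → ℂ) (hc : ∀ j, c j ≠ 0) {S : Set (J → ℂ)}
    (h0 : volume S ≠ 0) (htop : volume S ≠ ∞) :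
    ArchPacket.nlogVol J ((fun y : J → ℂ => fun j => c j * y j) '' S) =
      (Fintype.card J : ℝ)⁻¹ * ∑ j, Real.log ‖c j‖ + ArchPacket.nlogVol J S := by
  have hpos : ∀ j, 0 < ‖c j‖ := fun j => norm_pos_iff.mpr (hc j)
  have hprod : 0 < ∏ j, ‖c j‖ ^ 2 := Finset.prod_pos fun j _ => pow_pos (hpos j) 2
  have hS : 0 < (volume S).toReal := ENNReal.toReal_pos h0 htop
  have hcard : (0 : ℝ) < Fintype.card J := by exact_mod_cast Fintype.card_pos
  have hlog : Real.log (∏ j, ‖c j‖ ^ 2) = 2 * ∑ j, Real.log ‖c j‖ := by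
    rw [Real.log_prod (fun j _ => (pow_pos (hpos j) 2).ne'), Finset.mul_sum]
    exact Finset.sum_congr rfl fun j _ => by rw [Real.log_pow]; norm_num
  have hd : (Module.finrank ℝ (J → ℂ) : ℝ) = 2 * Fintype.card J := by
    rw [ArchPacket.finrank_packet]; push_cast; ring
  unfold ArchPacket.nlogVol
  rw [volume_image_coordMul, ENNReal.toReal_mul, ENNReal.toReal_ofReal hprod.le,
    Real.log_mul hprod.ne' hS.ne', hlog, hd]
  field_simp
  ring

end Coord

/-! ## On the tensor packet `M_I` through a decomposition -/

namespace Prop15iii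

open PiTensorProduct ArchPacket

variable {I V J : Type} [Fintype I] [DecidableEq I] [Fintype V] [Nonempty I] [Fintype J]

omit [Fintype I] [DecidableEq I] [Fintype V] [Nonempty I] [Fintype J] in
/-- A decomposition `Φ : M_I ≅ ⊕_J ℂ` is an algebra isomorphism, so multiplication by `t ∈ M_I` becomes
coordinatewise multiplication by `Φ(t)`: `Φ '' (t·S) = {(Φ(t)_j · y_j)_j | y ∈ Φ '' S}`.
[cite: Mochizuki2012, IUTchIV Prop. 1.5 (iii) p. 15] -/
theorem image_mul_eq_coordMul (Φ : Decomposition I V J) (t : MI I V) (S : Set (MI I V)) :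
    (Φ : MI I V → (J → ℂ)) '' ((fun x => t * x) '' S) =
      (fun y : J → ℂ => fun j => Φ t j * y j) '' ((Φ : MI I V → (J → ℂ)) '' S) := by
  rw [Set.image_image, Set.image_image]
  refine Set.image_congr fun x _ => ?_
  funext j
  rw [map_mul, Pi.mul_apply]

omit [Fintype I] [DecidableEq I] [Fintype V] [Nonempty I] in
/-- **Scaling of the packet log-volume on `M_I` under multiplication by an element** `t` with all coordinates
`Φ(t)_j ≠ 0` (e.g. a pure tensor of nonzero entries), for `S` of positive finite volume in the coordinates of
`Φ`: `packetLogVol Φ (t·S) = (1/|J|)·Σ_j log|Φ(t)_j| + packetLogVol Φ S` — the archimedean analogue of the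
nonarchimedean `μ^log(ι_i(g)·A) = μ^log(A) + log‖g‖` / `μ^log((⊗x_i)·A) = μ^log(A) + Σ_i log‖x_i‖`.
[cite: Mochizuki2012, IUTchIV Prop. 1.5 (iii) p. 15] -/
theorem packetLogVol_image_mul [Nonempty J] (Φ : Decomposition I V J) (t : MI I V) (ht : ∀ j, Φ t j ≠ 0)
    {S : Set (MI I V)} (h0 : volume ((Φ : MI I V → (J → ℂ)) '' S) ≠ 0)
    (htop : volume ((Φ : MI I V → (J → ℂ)) '' S) ≠ ∞) :
    packetLogVol Φ ((fun x => t * x) '' S) =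
      (Fintype.card J : ℝ)⁻¹ * ∑ j, Real.log ‖Φ t j‖ + packetLogVol Φ S := by
  rw [packetLogVol, image_mul_eq_coordMul, nlogVol_image_coordMul (fun j => Φ t j) ht h0 htop, packetLogVol]

/-- The coordinates of a pure tensor `⊗_i m_i` in the CANONICAL decomposition have absolute value
`∏_i |m_i(w_i)|` (the characters are `∏_i cj(ε_i)(m_i(w_i))` and `cj ∈ {id, conj}` preserves `|·|`).
[cite: Mochizuki2012, IUTchIV Prop. 1.5 (iii) p. 15] -/
theorem norm_canonicalDecomposition_tprod (m : I → M V) (idx : Idx I V) :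
    ‖canonicalDecomposition I V (tprod ℝ m) idx‖ = ∏ i, ‖m i (idx.1 i)‖ := by
  rw [canonicalDecomposition_tprod, norm_prod]
  refine Finset.prod_congr rfl fun i _ => ?_
  unfold cj
  split_ifs
  · exact Complex.norm_conj _
  · rfl

/-- Hence, for a pure tensor with all entries `m_i(v) ≠ 0`, every canonical coordinate is nonzero and
`log|Φ₀(⊗ m_i)_{(w,ε)}| = Σ_i log|m_i(w_i)|`. [cite: Mochizuki2012, IUTchIV Prop. 1.5 (iii) p. 15] -/
theorem log_norm_canonicalDecomposition_tprod (m : I → M V) (hm : ∀ i v, m i v ≠ 0)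
    (idx : Idx I V) :
    canonicalDecomposition I V (tprod ℝ m) idx ≠ 0 ∧
      Real.log ‖canonicalDecomposition I V (tprod ℝ m) idx‖ = ∑ i, Real.log ‖m i (idx.1 i)‖ := by
  have hpos : ∀ i, 0 < ‖m i (idx.1 i)‖ := fun i => norm_pos_iff.mpr (hm i _)
  refine ⟨?_, ?_⟩
  · rw [← norm_pos_iff, norm_canonicalDecomposition_tprod]
    exact Finset.prod_pos fun i _ => hpos i
  · rw [norm_canonicalDecomposition_tprod, Real.log_prod (fun i _ => (hpos i).ne')]

/-- **The archimedean capsule scaling law**: multiplying a region `S ⊆ M_I` of positive finite volume by a pure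
tensor `⊗_i m_i` (all `m_i(v) ∈ ℂ^×`) changes the packet log-volume (canonical decomposition, index set
`Idx = V^I × {±}^{I∖{i₀}}`) by the AVERAGE over `(w, ε) ∈ Idx` of `Σ_i log|m_i(w_i)|`.
[cite: Mochizuki2012, IUTchIV Prop. 1.5 (iii) p. 15] -/
theorem packetLogVol_image_tprod_mul [Nonempty V]
    (m : I → M V) (hm : ∀ i v, m i v ≠ 0) {S : Set (MI I V)}
    (h0 : volume ((canonicalDecomposition I V : MI I V → (Idx I V → ℂ)) '' S) ≠ 0)
    (htop : volume ((canonicalDecomposition I V : MI I V → (Idx I V → ℂ)) '' S) ≠ ∞) :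
    packetLogVol (canonicalDecomposition I V) ((fun x => tprod ℝ m * x) '' S) =
      (Fintype.card (Idx I V) : ℝ)⁻¹ * ∑ idx : Idx I V, ∑ i, Real.log ‖m i (idx.1 i)‖ +
        packetLogVol (canonicalDecomposition I V) S := by
  rw [packetLogVol_image_mul (canonicalDecomposition I V) (tprod ℝ m)
    (fun idx => (log_norm_canonicalDecomposition_tprod m hm idx).1) h0 htop]
  congr 2
  exact Finset.sum_congr rfl fun idx _ => (log_norm_canonicalDecomposition_tprod m hm idx).2

end Prop15iii

end Literature.IUT.LogVolume

end
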